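import Summits.Ventures.HodgeRepro2.T5BergmanSchurGeneral

/-!
# The matrix coefficients of the coherent states in closed form, and the integral formula
`∫_G |j(g⁻¹, w)|^{-2k} dμ_R = (1 - |w|²)^{-k}/(k-1)`

The coherent states `K_z(w) = (1 - z̄ w)^{-k}` (`T5BergmanKernel.kernel`) reproduce: `⟨f, K_w⟩_k = π/(k-1) f(w)`.
Hence every matrix coefficient against a coherent state is a VALUE of the translated vector
(`matrixCoeff_kernel_right`: `⟨π_k(g) f, K_w⟩_k = π/(k-1) (π_k(g) f)(w)`), and for two coherent states
(`matrixCoeff_kernel_kernel`, `matrixCoeff_kernel_kernel_explicit`)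

  `⟨π_k(g) K_z, K_w⟩_k = π/(k-1) · a_z^k · j((g s_z)⁻¹, w)^{-k}`,   `a_z = mat (sec z) 0 0`, `|a_z|² = (1-|z|²)⁻¹`.

The general Schur relation then evaluates an explicit integral over `SU(1,1)` (`integral_norm_act_kernel_sq`,
`integral_norm_denom_inv_pow`):

  `∫_G |j(g⁻¹, w)|^{-2k} dμ_R(g) = (1 - |w|²)^{-k} / (k-1)`   for every `w ∈ 𝔻`, `k ≥ 2`,

the `w = 0` case being the lowest-weight formal-degree relation
`T5BergmanRuhlModel.integral_norm_ruhlInner_lowest_act_sq`.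

Blind lane: Mathlib + the HodgeRepro2 prefix only; no sorry; axioms ⊆ {propext, Classical.choice,
Quot.sound}.
-/

namespace Summit.Ventures.HodgeRepro2.T5BergmanCoherentStates

open MeasureTheory MeasureTheory.Measure Metric Filter Topology
open T5PoincareDensity T5SU11Unimodular T5SU11Fibration T5HaarCircle T5SU11CoefficientL2
open T5BergmanCoefficient T5BergmanPairing T5BergmanUnitary T5BergmanFourier T5BergmanKernel
  T5BergmanParseval T5BergmanActStable T5BergmanMatrixCoeff T5BergmanSchur T5BergmanCoeffL2
  T5BergmanSchurGeneral
open scoped Real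

/-! ### The reproducing property in matrix-coefficient form -/

/-- `⟨π_k(g) f, K_w⟩_k = π/(k-1) · (π_k(g) f)(w)` for holomorphic `f ∈ A_k`, `w ∈ 𝔻`. -/
theorem matrixCoeff_kernel_right (k : ℕ) (hk : 2 ≤ k) (f : ℂ → ℂ) (hf : DifferentiableOn ℂ f (ball 0 1))
    (hfint : IntegrableOn (fun w => ‖f w‖ ^ 2 * (1 - ‖w‖ ^ 2) ^ (k - 2)) (ball (0 : ℂ) 1))
    {w : ℂ} (hw : w ∈ ball (0 : ℂ) 1) (g : SU11) :
    matrixCoeff k f (kernel k w) g = ((π / ((k : ℝ) - 1) : ℝ) : ℂ) * act k g f w := by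
  unfold matrixCoeff
  exact pairing_kernel k hk _ (act k g f) (hasSum_taylor _ (differentiableOn_act k g f hf))
    (integrableOn_act k hk g f hf hfint) hw

/-- **Two coherent states**: `⟨π_k(g) K_z, K_w⟩_k = π/(k-1) · (π_k(g) K_z)(w)`. -/
theorem matrixCoeff_kernel_kernel (k : ℕ) (hk : 2 ≤ k) {z w : ℂ} (hz : z ∈ ball (0 : ℂ) 1)
    (hw : w ∈ ball (0 : ℂ) 1) (g : SU11) :
    matrixCoeff k (kernel k z) (kernel k w) g =
      ((π / ((k : ℝ) - 1) : ℝ) : ℂ) * act k g (kernel k z) w :=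
  matrixCoeff_kernel_right k hk (kernel k z) (differentiableOn_kernel k hz) (integrableOn_kernel k hz)
    hw g

/-- **Closed form**: `⟨π_k(g) K_z, K_w⟩_k = π/(k-1) · a_z^k · j((g s_z)⁻¹, w)^{-k}` with `a_z = mat (sec z) 0 0`
(the coherent state is the translate `a_z^k π_k(s_z) 1` of the lowest-weight vector). -/
theorem matrixCoeff_kernel_kernel_explicit (k : ℕ) (hk : 2 ≤ k) {z w : ℂ} (hz : z ∈ ball (0 : ℂ) 1)
    (hw : w ∈ ball (0 : ℂ) 1) (g : SU11) :
    matrixCoeff k (kernel k z) (kernel k w) g =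
      ((π / ((k : ℝ) - 1) : ℝ) : ℂ) * ((mat (sec z) 0 0) ^ k * (denom (mat (g * sec z)⁻¹) w)⁻¹ ^ k) := by
  rw [matrixCoeff_kernel_eq k hz (kernel k w) g]
  have h := matrixCoeff_kernel_right k hk lowest (differentiableOn_const 1)
    (by simpa [lowest] using integrableOn_monomial k 0) hw (g * sec z)
  rw [matrixCoeff_lowest] at h
  rw [h, act_lowest_apply]
  ring

/-! ### The integral formula -/

variable [MeasurableSpace Circle] [BorelSpace Circle]

/-- **Schur for the coherent states, evaluated**:
`∫_G |(π_k(g) K_z)(w)|² dμ_R(g) = (1-|z|²)^{-k} (1-|w|²)^{-k} / (k-1)`. -/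
theorem integral_norm_act_kernel_sq (k : ℕ) (hk : 2 ≤ k) {z w : ℂ} (hz : z ∈ ball (0 : ℂ) 1)
    (hw : w ∈ ball (0 : ℂ) 1) :
    ∫ g, ‖act k g (kernel k z) w‖ ^ 2 ∂ruhl =
      (1 - ‖z‖ ^ 2)⁻¹ ^ k * (1 - ‖w‖ ^ 2)⁻¹ ^ k / ((k : ℝ) - 1) := by
  have hk1 : (0 : ℝ) < (k : ℝ) - 1 := by
    have : (2 : ℝ) ≤ k := by exact_mod_cast hk
    linarith
  have hπ : (0 : ℝ) < π := Real.pi_pos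
  have hs := schur k hk (kernel k z) (kernel k w) (differentiableOn_kernel k hz) (integrableOn_kernel k hz)
    (differentiableOn_kernel k hw) (integrableOn_kernel k hw)
  have e : ∀ g : SU11, ‖pairing k (act k g (kernel k z)) (kernel k w)‖ ^ 2 =
      (π / ((k : ℝ) - 1)) ^ 2 * ‖act k g (kernel k z) w‖ ^ 2 := by
    intro g
    have := matrixCoeff_kernel_kernel k hk hz hw g
    unfold matrixCoeff at this
    rw [this, norm_mul, mul_pow, Complex.norm_real, Real.norm_eq_abs, sq_abs]
  simp_rw [e] at hs
  rw [integral_const_mul, pairing_kernel_self k hk hz, pairing_kernel_self k hk hw] at hs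
  simp only [Complex.re_ofReal_mul, Complex.ofReal_re] at hs
  have hc : (π / ((k : ℝ) - 1)) ^ 2 ≠ 0 := by positivity
  rw [eq_div_iff hk1.ne'] at hs ⊢
  apply mul_left_cancel₀ hc
  linear_combination hs

omit [MeasurableSpace Circle] [BorelSpace Circle] in
/-- `K_0 = 1`, the lowest-weight vector. -/
lemma kernel_zero (k : ℕ) : kernel k 0 = lowest := by
  funext w
  simp [kernel, lowest]

/-- **The integral formula**: `∫_G |j(g⁻¹, w)|^{-2k} dμ_R(g) = (1 - |w|²)^{-k} / (k-1)` for `w ∈ 𝔻`, `k ≥ 2`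
(the case `z = 0` of `integral_norm_act_kernel_sq`; `w = 0` is the lowest-weight formal-degree relation). -/
theorem integral_norm_denom_inv_pow (k : ℕ) (hk : 2 ≤ k) {w : ℂ} (hw : w ∈ ball (0 : ℂ) 1) :
    ∫ g, (‖denom (mat g⁻¹) w‖⁻¹) ^ (2 * k) ∂ruhl = (1 - ‖w‖ ^ 2)⁻¹ ^ k / ((k : ℝ) - 1) := by
  have h := integral_norm_act_kernel_sq k hk (mem_ball_self one_pos) hw
  rw [kernel_zero] at h
  simp only [norm_zero, zero_pow two_ne_zero, sub_zero, inv_one, one_pow, one_mul] at h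
  rw [← h]
  congr 1
  funext g
  rw [act_lowest_apply, norm_pow, norm_inv, ← pow_mul, mul_comm]

end Summit.Ventures.HodgeRepro2.T5BergmanCoherentStates
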